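import Literature.NumberTheory.EllipticCurves.IwasawaSelmerControlLocalInputsProofs
import HarnessLib

/-!
# Route `ByReductionTypeAtTwo` (K4), TOWER road — the dévissage `0 → Ê(𝔪_∞)/(g−1) → E(K_{∞,η})/(g−1) → Ẽ(𝔽_p) → 0`
# at a place above `p`, EXACT on `p`-power torsion: `#(M/(g−1)M)[p^∞] = #(M₁/(g−1)M₁)[p^∞] · #red₀(M)[p^∞]`

Cell `bsd-2adic`, seat `bsd-2adic-tower-1` (GEN 25), `--supports stmt-BirchSwinnertonDyer-19271` (helper). TOOL theorems
only (no definition, no named fact, no `sorry`); closes nothing by itself; BSD is not proved by any of this. Part (b₂) of the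
programme «Greenberg LNM 1716 Lemma 3.4 at layer `0` EXACT ⇒ Thm. 4.1 over `ℚ` ⇒ the `hEC` binder of the TOWER doors in the
kernel» (siblings `…EulerCharLayerZero.lean`, `…EulerCharCoinvExact.lean`, `…EulerCharCoinvInput.lean`).

Greenberg's count `#ker(r_v) = #Ẽ(𝔽_p)_p²` (Lemma 3.4, p. 89) splits along the reduction sequence
`0 → M₁ → M → Ẽ(𝔽_p) → 0`, `M = E(K̄_v)^{H_∞}`, `M₁ = M ∩ Ê(𝔪̄)`: with `g` an INERTIAL topological generator of `Γ/H_∞`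
one has `(g − 1)M ⊆ M₁` and `(g − 1)M = (g − 1)M₁` (Hensel lifts into `E(K_v) = M^g`), hence
`0 → M₁/(g−1)M₁ → M/(g−1)M → red₀(M) → 0`; it stays exact on `p`-power torsion as soon as every `a ∈ M₁` is, for every `k`,
of the form `p^j a = (g m − m) + p^{k+j} R` with `m, R ∈ M₁` (`(M₁ ⊗ ℚ_p/ℤ_p)_Γ = 0`, sibling `…EulerCharCoinvInput.lean`).

* §2 `natCard_primary_quotient_eq_mul` — abstract dévissage for `D : M → M`, `r : M → B` with `r ∘ D = 0`, Hensel lifts,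
  `M₁ = ker r ↪ M` with `D₁`, and the divisibility input: `#(M/DM)[p^∞] = #(M₁/D₁M₁)[p^∞] · #r(M)[p^∞]` (with finiteness).
* §5 `natCard_primary_coinv_eq_mul` — the instance `M = E(K̄_E)^{H_{E,∞}}`, `D = g − 1`, `r = red₀|_M` (any `K`, `E`, `κ`).

References: [GreenbergLNM1716] §3 Lemma 3.4 (p. 89), §4 p. 108.
-/

set_option autoImplicit false
-- justification: the mandated namespace `Summit.BirchSwinnertonDyer.BirchSwinnertonDyer.Theorems`
-- (single-conjunct summit, Sub = Summit) repeats a segment by design (D-0017).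
set_option linter.dupNamespace false

noncomputable section

open scoped Classical

universe u

namespace Summit.BirchSwinnertonDyer.BirchSwinnertonDyer.Theorems.GoodOrdTower

open Literature.NumberTheory.GaloisRepresentations Literature.NumberTheory.EllipticCurves WeierstrassCurve
  Literature.NumberTheory.EllipticCurves.ResKernel

/-! ## §2 Abstract dévissage of the coinvariant `p`-power torsion along a reduction map -/

section Algebra

variable {M B : Type*} [AddCommGroup M] [AddCommGroup B]

omit [AddCommGroup B] in
/-- In an additive group, `p ^ k • x = 0` for SOME `k` iff `x` lies in the `p`-primary component. [folklore] -/
private theorem mem_primaryComponent_iff' (p : ℕ) (x : M) :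
    x ∈ AddCommGroup.primaryComponent M p ↔ ∃ k : ℕ, p ^ k • x = 0 :=
  AddCommGroup.mem_primaryComponent

set_option maxHeartbeats 1600000 in
/-- **Abstract dévissage: `#(M/DM)[p^∞] = #(M₁/D₁M₁)[p^∞] · #r(M)[p^∞]`.** Let `D : M → M` and `r : M → B` be additive with
`r ∘ D = 0` (`hrD`), every `r x` attained on `ker D` (`hlift`, Hensel), `j : M₁ ↪ M` an embedding onto `ker r` (`hrj`) with
`D₁ : M₁ → M₁` over `D` (`hDj`), and suppose (hdiv) every `a ∈ ker r` satisfies, for every `k`, `p^i a = D m + p^{k+i} (j R)` for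
some `i`, `m`, `R`. Then `0 → M₁/D₁M₁ → M/DM → r(M) → 0` is exact and stays exact on `p`-power torsion, so if
`(M₁/D₁M₁)[p^∞]` and `r(M)` are finite then `(M/DM)[p^∞]` is finite of order `#(M₁/D₁M₁)[p^∞] · #(r(M))[p^∞]`.
[cite: GreenbergLNM1716, §3 Lemma 3.4 (p. 89)] -/
theorem natCard_primary_quotient_eq_mul (p : ℕ) (D : M →+ M) (r : M →+ B) (hrD : ∀ x, r (D x) = 0)
    (hlift : ∀ x : M, ∃ x₀ : M, D x₀ = 0 ∧ r x₀ = r x)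
    {M₁ : Type*} [AddCommGroup M₁] (j : M₁ →+ M) (hj : Function.Injective j)
    (hrj : ∀ y : M, r y = 0 ↔ ∃ x : M₁, j x = y) (D₁ : M₁ →+ M₁) (hDj : ∀ x : M₁, j (D₁ x) = D (j x))
    (hdiv : ∀ a : M, r a = 0 → ∀ k : ℕ, ∃ (i : ℕ) (m : M) (R : M₁), p ^ i • a = D m + p ^ (k + i) • j R)
    [Finite (AddCommGroup.primaryComponent (M₁ ⧸ D₁.range) p)] [Finite r.range] :
    Finite (AddCommGroup.primaryComponent (M ⧸ D.range) p) ∧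
      Nat.card (AddCommGroup.primaryComponent (M ⧸ D.range) p) =
        Nat.card (AddCommGroup.primaryComponent (M₁ ⧸ D₁.range) p) *
          Nat.card (AddCommGroup.primaryComponent r.range p) := by
  -- `ker r = j(M₁)` and `D(M) = j(D₁(M₁))`
  have hrj0 : ∀ x : M₁, r (j x) = 0 := fun x ↦ (hrj (j x)).mpr ⟨x, rfl⟩
  have hDrange : ∀ y : M, ∃ x : M₁, j (D₁ x) = D y := by
    intro y
    obtain ⟨y₀, hy₀, hry₀⟩ := hlift y
    obtain ⟨x, hx⟩ := (hrj (y - y₀)).mp (by rw [map_sub, hry₀, sub_self])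
    exact ⟨x, by rw [hDj, hx, map_sub, hy₀, sub_zero]⟩
  -- the induced maps `ι : M₁/D₁M₁ → M/DM` and `r̄ : M/DM → B`
  let ι : M₁ ⧸ D₁.range →+ M ⧸ D.range :=
    QuotientAddGroup.map D₁.range D.range j fun x hx ↦ by
      obtain ⟨y, rfl⟩ := hx
      exact ⟨j y, (hDj y).symm⟩
  have hι : ∀ x : M₁, ι (QuotientAddGroup.mk x) = QuotientAddGroup.mk (j x) := fun _ ↦ rfl
  have hιinj : Function.Injective ι := by
    rw [injective_iff_map_eq_zero]
    intro q hq
    obtain ⟨x, rfl⟩ := QuotientAddGroup.mk_surjective q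
    rw [hι, QuotientAddGroup.eq_zero_iff] at hq
    obtain ⟨y, hy⟩ := hq
    obtain ⟨x', hx'⟩ := hDrange y
    rw [QuotientAddGroup.eq_zero_iff]
    exact ⟨x', hj (by rw [hx', hy])⟩
  let rbar : M ⧸ D.range →+ B :=
    QuotientAddGroup.lift D.range r fun y hy ↦ by
      obtain ⟨x, rfl⟩ := hy
      exact hrD x
  have hrbar : ∀ x : M, rbar (QuotientAddGroup.mk x) = r x := fun _ ↦ rfl
  have hker : ∀ q : M ⧸ D.range, rbar q = 0 ↔ ∃ q₁, ι q₁ = q := by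
    intro q
    obtain ⟨x, rfl⟩ := QuotientAddGroup.mk_surjective q
    rw [hrbar]
    constructor
    · intro hx
      obtain ⟨x₁, hx₁⟩ := (hrj x).mp hx
      exact ⟨QuotientAddGroup.mk x₁, by rw [hι, hx₁]⟩
    · rintro ⟨q₁, hq₁⟩
      obtain ⟨x₁, rfl⟩ := QuotientAddGroup.mk_surjective q₁
      rw [hι, QuotientAddGroup.eq_iff_sub_mem] at hq₁
      obtain ⟨y, hy⟩ := hq₁
      have : x = j x₁ - D y := by rw [hy]; abel
      rw [this, map_sub, hrj0, hrD, sub_zero]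
  -- the `p`-primary parts
  let Qp := AddCommGroup.primaryComponent (M ⧸ D.range) p
  let Q₁p := AddCommGroup.primaryComponent (M₁ ⧸ D₁.range) p
  let Rp := AddCommGroup.primaryComponent r.range p
  -- `φ : Qp → Rp`, the restriction of `r̄`
  let φ : Qp →+ Rp :=
    { toFun := fun q ↦ ⟨⟨rbar q.1, by
          obtain ⟨x, hx⟩ := QuotientAddGroup.mk_surjective (q.1 : M ⧸ D.range)
          exact ⟨x, by rw [← hx, hrbar]⟩⟩, by
          obtain ⟨k, hk⟩ := (mem_primaryComponent_iff' p _).mp q.2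
          exact (mem_primaryComponent_iff' p _).mpr ⟨k, Subtype.ext (by
            rw [AddSubmonoidClass.coe_nsmul, ZeroMemClass.coe_zero]
            change p ^ k • rbar q.1 = 0
            rw [← map_nsmul, hk, map_zero])⟩⟩
      map_zero' := Subtype.ext (Subtype.ext (by simp))
      map_add' := fun a b ↦ Subtype.ext (Subtype.ext (by simp)) }
  have hφ : ∀ q : Qp, ((φ q : Rp) : r.range) = rbar q.1 := fun _ ↦ rfl
  -- `ker φ ≃ Q₁p`
  let ψ : Q₁p → φ.ker := fun q₁ ↦ ⟨⟨ι q₁.1, by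
      obtain ⟨k, hk⟩ := (mem_primaryComponent_iff' p _).mp q₁.2
      exact (mem_primaryComponent_iff' p _).mpr ⟨k, by rw [← map_nsmul, hk, map_zero]⟩⟩,
    (AddMonoidHom.mem_ker).mpr (Subtype.ext (Subtype.ext (by
      rw [hφ]; exact (hker _).mpr ⟨q₁.1, rfl⟩)))⟩
  have hψbij : Function.Bijective ψ := by
    constructor
    · intro a b hab
      have h := congrArg (fun z : φ.ker ↦ ((z : Qp) : M ⧸ D.range)) hab
      exact Subtype.ext (hιinj h)
    · rintro ⟨q, hq⟩
      have hq0 : rbar q.1 = 0 := by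
        have h := congrArg (fun z : Rp ↦ ((z : r.range) : B)) ((AddMonoidHom.mem_ker).mp hq)
        simpa only [hφ, ZeroMemClass.coe_zero] using h
      obtain ⟨q₁, hq₁⟩ := (hker _).mp hq0
      obtain ⟨k, hk⟩ := (mem_primaryComponent_iff' p _).mp q.2
      have hq₁p : q₁ ∈ Q₁p := (mem_primaryComponent_iff' p _).mpr ⟨k, hιinj (by
        rw [map_nsmul, hq₁, map_zero]; exact hk)⟩
      exact ⟨⟨q₁, hq₁p⟩, Subtype.ext (Subtype.ext hq₁)⟩
  -- `φ` is onto: a `p^k`-torsion reduction lifts to a `p`-power-torsion class (the divisibility input)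
  have hφsurj : Function.Surjective φ := by
    rintro ⟨⟨z, hz⟩, hzp⟩
    obtain ⟨k, hk⟩ := (mem_primaryComponent_iff' p _).mp hzp
    have hk' : p ^ k • z = 0 := by
      have h := congrArg (fun y : r.range ↦ (y : B)) hk
      simpa only [AddSubmonoidClass.coe_nsmul, ZeroMemClass.coe_zero] using h
    obtain ⟨x, rfl⟩ := hz
    obtain ⟨x₀, hx₀, hrx₀⟩ := hlift x
    -- `a = p^k x₀ ∈ ker r`
    obtain ⟨i, m, R, hrel⟩ := hdiv (p ^ k • x₀) (by rw [map_nsmul, hrx₀, hk']) k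
    -- the class of `x₀ - j R` is `p^{k+i}`-torsion and reduces to `r x`
    refine ⟨⟨QuotientAddGroup.mk (x₀ - j R), (mem_primaryComponent_iff' p _).mpr ⟨k + i, ?_⟩⟩,
      Subtype.ext (Subtype.ext ?_)⟩
    · rw [← QuotientAddGroup.mk_nsmul, QuotientAddGroup.eq_zero_iff]
      refine ⟨m, ?_⟩
      rw [smul_sub, show p ^ (k + i) • x₀ = p ^ i • (p ^ k • x₀) by rw [pow_add, mul_comm, mul_smul], hrel]
      abel
    · rw [hφ]
      change rbar (QuotientAddGroup.mk (x₀ - j R)) = r x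
      rw [hrbar, map_sub, hrj0, sub_zero, hrx₀]
  -- counting
  haveI : Finite φ.ker := Finite.of_equiv _ (Equiv.ofBijective ψ hψbij)
  haveI : Finite Rp := inferInstance
  have hcardker : Nat.card φ.ker = Nat.card Q₁p := (Nat.card_congr (Equiv.ofBijective ψ hψbij)).symm
  have hquot : Nat.card (Qp ⧸ φ.ker) = Nat.card Rp :=
    Nat.card_congr (QuotientAddGroup.quotientKerEquivOfSurjective φ hφsurj).toEquiv
  haveI : Finite (Qp ⧸ φ.ker) := Nat.finite_of_card_ne_zero (by rw [hquot]; exact Nat.card_pos.ne')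
  haveI hQpfin : Finite Qp := by
    refine Nat.finite_of_card_ne_zero ?_
    rw [φ.ker.card_eq_card_quotient_mul_card_addSubgroup, hquot, hcardker]
    exact mul_ne_zero Nat.card_pos.ne' Nat.card_pos.ne'
  refine ⟨hQpfin, ?_⟩
  rw [φ.ker.card_eq_card_quotient_mul_card_addSubgroup, hquot, hcardker, mul_comm]

end Algebra

/-! ## §5 The dévissage at a place above `p`: `#(M/(g−1)M)[p^∞] = #(M₁/(g−1)M₁)[p^∞] · #red₀(M)[p^∞]` -/

section DevissageAtP

variable {K : Type u} [Field K] (W : WeierstrassCurve K) {p : ℕ} [hp : Fact p.Prime] (κ : ZpExtension K p)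
  (E : Type u) [Field E] [Algebra K E]

set_option maxHeartbeats 1600000 in
/-- **Dévissage of the coinvariant `p`-power torsion along the reduction map.** Let `M = E(K̄_E)^{H_{E,∞}}`, `g ∈ Γ_E` act
trivially on reductions (`hgred`, an inertial generator), let every reduction of a point of `M` be attained on `M^g` (`hlift`,
Hensel), `M₁ = M ∩ ker red₀` with `D₁ = g − 1` (`hM₁`, `hD₁`), and suppose (hdiv) every `a ∈ M₁` satisfies
`p^j a = (g m − m) + p^{k+j} R` with `m, R ∈ M₁` for every `k` (§3 at a good ordinary `v ∣ p`). If `(M₁/(g−1)M₁)[p^∞]` and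
`red₀(M)` are finite, then `(M/(g−1)M)[p^∞]` is finite and
**`#(M/(g−1)M)[p^∞] = #(M₁/(g−1)M₁)[p^∞] · #red₀(M)[p^∞]`** (§2 with `r = red₀|_M`). [cite: GreenbergLNM1716, §3 Lemma 3.4 (p. 89)] -/
theorem natCard_primary_coinv_eq_mul {B : Type*} [AddCommGroup B] (red₀ : localPoints W E →+ B)
    {g : Field.absoluteGaloisGroup E} (hgred : ∀ Q : localPoints W E, red₀ (g • Q) = red₀ Q)
    (hlift : ∀ x : FixedPoints.addSubgroup (localSubgroup κ.kerSubgroup E) (localPoints W E),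
      ∃ x₀ : FixedPoints.addSubgroup (localSubgroup κ.kerSubgroup E) (localPoints W E),
        subOne (localSubgroup κ.kerSubgroup E) (localPoints W E) g x₀ = 0 ∧
          red₀ (x₀ : localPoints W E) = red₀ (x : localPoints W E))
    (M₁ : AddSubgroup (localPoints W E))
    (hM₁ : ∀ a, a ∈ M₁ ↔ a ∈ red₀.ker ∧ ∀ h ∈ localSubgroup κ.kerSubgroup E, h • a = a)
    (D₁ : M₁ →+ M₁) (hD₁ : ∀ a : M₁, ((D₁ a : M₁) : localPoints W E) = g • (a : localPoints W E) - a)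
    (hdiv : ∀ a : localPoints W E, red₀ a = 0 → (∀ τ ∈ localSubgroup κ.kerSubgroup E, τ • a = a) → ∀ k : ℕ,
      ∃ (j : ℕ) (m R : localPoints W E), red₀ m = 0 ∧ red₀ R = 0 ∧
        (∀ τ ∈ localSubgroup κ.kerSubgroup E, τ • m = m) ∧ (∀ τ ∈ localSubgroup κ.kerSubgroup E, τ • R = R) ∧
        p ^ j • a = (g • m - m) + p ^ (k + j) • R)
    [Finite (AddCommGroup.primaryComponent (M₁ ⧸ D₁.range) p)]
    [Finite (red₀.comp (FixedPoints.addSubgroup (localSubgroup κ.kerSubgroup E) (localPoints W E)).subtype).range] :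
    Finite (AddCommGroup.primaryComponent
      (FixedPoints.addSubgroup (localSubgroup κ.kerSubgroup E) (localPoints W E) ⧸
        (subOne (localSubgroup κ.kerSubgroup E) (localPoints W E) g).range) p) ∧
    Nat.card (AddCommGroup.primaryComponent
      (FixedPoints.addSubgroup (localSubgroup κ.kerSubgroup E) (localPoints W E) ⧸
        (subOne (localSubgroup κ.kerSubgroup E) (localPoints W E) g).range) p) =
      Nat.card (AddCommGroup.primaryComponent (M₁ ⧸ D₁.range) p) *
        Nat.card (AddCommGroup.primaryComponent
          (red₀.comp (FixedPoints.addSubgroup (localSubgroup κ.kerSubgroup E) (localPoints W E)).subtype).range p) := by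
  -- notation
  let P : Type u := localPoints W E
  let Hi : Subgroup (Field.absoluteGaloisGroup E) := localSubgroup κ.kerSubgroup E
  let M : AddSubgroup P := FixedPoints.addSubgroup Hi P
  let D : M →+ M := subOne Hi P g
  let r : M →+ B := red₀.comp M.subtype
  have hr : ∀ x : M, r x = red₀ (x : P) := fun _ ↦ rfl
  -- the embedding `j : M₁ ↪ M` over `D`
  have hle : M₁ ≤ M := fun a ha ↦ (FixedPoints.mem_addSubgroup _ _ _).mpr fun τ ↦ ((hM₁ a).mp ha).2 τ τ.2
  let j : M₁ →+ M := AddSubgroup.inclusion hle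
  have hjcoe : ∀ x : M₁, ((j x : M) : P) = (x : P) := fun _ ↦ rfl
  have hj : Function.Injective j := AddSubgroup.inclusion_injective hle
  have hrD : ∀ x : M, r (D x) = 0 := fun x ↦ by
    rw [hr, coe_subOne_apply, map_sub, hgred, sub_self]
  have hlift' : ∀ x : M, ∃ x₀ : M, D x₀ = 0 ∧ r x₀ = r x := fun x ↦ by
    obtain ⟨x₀, h0, hx₀⟩ := hlift x
    exact ⟨x₀, h0, hx₀⟩
  have hrj : ∀ y : M, r y = 0 ↔ ∃ x : M₁, j x = y := by
    intro y
    constructor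
    · intro hy
      refine ⟨⟨(y : P), (hM₁ _).mpr ⟨(AddMonoidHom.mem_ker).mpr hy, fun τ hτ ↦ y.2 ⟨τ, hτ⟩⟩⟩, Subtype.ext rfl⟩
    · rintro ⟨x, rfl⟩
      exact (AddMonoidHom.mem_ker).mp ((hM₁ _).mp x.2).1
  have hDj : ∀ x : M₁, j (D₁ x) = D (j x) := fun x ↦ Subtype.ext (by
    rw [hjcoe, hD₁, coe_subOne_apply, hjcoe])
  have hdiv' : ∀ a : M, r a = 0 → ∀ k : ℕ, ∃ (i : ℕ) (m : M) (R : M₁), p ^ i • a = D m + p ^ (k + i) • j R := by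
    intro a ha k
    obtain ⟨i, m, R, hm0, hR0, hm, hR, heq⟩ := hdiv (a : P) ha (fun τ hτ ↦ a.2 ⟨τ, hτ⟩) k
    refine ⟨i, ⟨m, (FixedPoints.mem_addSubgroup _ _ _).mpr fun τ ↦ hm τ τ.2⟩,
      ⟨R, (hM₁ R).mpr ⟨(AddMonoidHom.mem_ker).mpr hR0, hR⟩⟩, Subtype.ext ?_⟩
    simp only [AddSubgroup.coe_nsmul, AddSubgroup.coe_add, hjcoe]
    exact heq
  exact natCard_primary_quotient_eq_mul p D r hrD hlift' j hj hrj D₁ hDj hdiv'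

end DevissageAtP

end Summit.BirchSwinnertonDyer.BirchSwinnertonDyer.Theorems.GoodOrdTower

end
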